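import Summits.BirchSwinnertonDyer.BirchSwinnertonDyer.Theorems.AdditiveKolyvaginRoadLocalDictionaries
import Summits.BirchSwinnertonDyer.BirchSwinnertonDyer.Theorems.AdditiveKolyvaginRoadKolyvaginGrossBridge
import Summits.BirchSwinnertonDyer.BirchSwinnertonDyer.Theorems.Rank1ResidualJetKolyvaginDecompositionTrivial
import Summits.BirchSwinnertonDyer.BirchSwinnertonDyer.Theorems.KolyvaginRoadThreeMethod2KolyvaginLine
import HarnessLib

/-!
# Route `AdditiveKolyvaginRoad`, crux `KolyvaginPrimitiveAdditive` (item stmt-BirchSwinnertonDyer-20132):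
# stub LOC, input (Line) at a GENERAL odd prime `p` — the KUMMER EIGEN-LINE at a Kolyvagin prime
# (cell `pub/bsd-wall`, lead prover `bsd-wall-akr-p1` g3; `--supports stmt-BirchSwinnertonDyer-20132`, helper;
# p-generic port of zhang3-p1's `…Method2KolyvaginLine.lean`)

WHY THIS FILE. After `kolyvaginLocalPackageP_of_kolyvaginPrimePackage` (p533303) and (Tr-iso) (p535599), stub LOC of
skeleton v7.1 of crux 20132 is (Perf) + (Line) + (Supply). This file DISCHARGES (Line) at every odd prime `p` with
`ρ̄_{E,p}` onto: after its frame arguments (`hK hp2 hsurj c hc`) `exists_kummerEigenLine_P` has literally the type of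
the binder `hline` of `kolyvaginLocalPackageP_of_kolyvaginPrimePackage`.

WHAT. For each sign `s` the localisations at `λ ∋ ℓ` of the `c`-eigenclasses `x ∈ H¹(K, E[p])^{s}` that are Selmer at
`λ` lie on ONE integral line of `H¹(K_λ, E[p])` (W. Zhang Lemma 8.4 (1) `dim H¹_f(K_λ, E[p])^± = 1`): Gross's Frobenius
lift at `λ` (`exists_frobeniusLift_of_isKolyvaginPrime` at level `p¹`, through the bridge
`isKolyvaginPrime_pow_one_of_zhang`), Prop. 9.6 (`mem_torsionLocalKer_iff_h1Eval_eq_zero`: for `x` Selmer at `λ`,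
`loc_λ x = 0 ⟺ [x, F] = 0`), `[x, F]` a `t`-eigenvector of sign `s` (`torsionMap_h1Eval_eq_of_conjAct_eq`), and the
eigen-line counting `KolyLocal.mem_zmultiples_of_eigen_of_eigen` (any odd prime); zhang3-p1's proof verbatim up to
`3 ↦ p¹`, good reduction at `λ` from bsd-jet's `hasGoodReductionAt_of_zhangKolyvaginPrime`.

HONEST FRAMING: one theorem; 0 definitions, 0 named facts, 0 `sorry`; closes nothing by itself (reduces stub LOC to
(Perf) + (Supply)).

References: [cite: WZhang2014, Lemma 8.4 (1), §8.1] [cite: GrossLMS1991, Prop. 8.1, Prop. 9.6].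
-/

-- single-conjunct summit: `Summit.BirchSwinnertonDyer.BirchSwinnertonDyer.…` repeats the name by design
set_option linter.dupNamespace false

noncomputable section

open scoped Classical

namespace Summit.BirchSwinnertonDyer.BirchSwinnertonDyer.Theorems.AdditiveKoly

open WeierstrassCurve Field Function NumberField IsDedekindDomain Rat.HeightOneSpectrum
open Literature.NumberTheory.EllipticCurves Literature.NumberTheory.GaloisRepresentations Module
open Summit.BirchSwinnertonDyer.Rank1Residual.X11b.Three.Koly.Method2
open Summit.BirchSwinnertonDyer.Rank1Residual.JET

/-! ## §3 (Line): the Kummer eigen-line at a Kolyvagin prime, general odd `p` -/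

section Line

variable (W : WeierstrassCurve ℚ) (K : Type) [Field K] [NumberField K] (p : ℕ) [W.IsElliptic] [W.IsGloballyMinimal]
  [Fact p.Prime]

/-- **(Line) at a Kolyvagin prime of a ♯ frame, general odd `p`** — after `hK hp2 hsurj c hc` literally the binder
`hline` of `kolyvaginLocalPackageP_of_kolyvaginPrimePackage`: for each sign `s` there is `e ∈ H¹(K_λ, E[p])` with
`loc_λ x ∈ ℤ e` for every `c`-eigenclass `x ∈ H¹(K, E[p])^{s}` Selmer at `λ`. Proof = zhang3-p1's at `3 ↦ p¹`: Gross's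
Frobenius lift at `λ` (`exists_frobeniusLift_of_isKolyvaginPrime`, via §2), Prop. 9.6
(`mem_torsionLocalKer_iff_h1Eval_eq_zero`: for `x` Selmer at `λ`, `loc_λ x = 0 ⟺ [x, F] = 0`), `[x, F]` a
`t`-eigenvector of sign `s`, and the eigen-line counting `mem_zmultiples_of_eigen_of_eigen`.
[cite: WZhang2014, Lemma 8.4 (1), §8.1] [cite: GrossLMS1991, Prop. 8.1, Prop. 9.6] -/
theorem exists_kummerEigenLine_P (hK : IsImaginaryQuadratic K) (hp2 : p ≠ 2)
    (hsurj : W.HasSurjectiveModNGaloisRep p) (c : K ≃ₐ[ℚ] K) (hc : c ≠ 1)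
    (ℓ : ℕ) (hℓ : Zhang2014.IsKolyvaginPrime (W.conductorNorm ℤ) W K p ℓ)
    (v : HeightOneSpectrum (𝓞 K)) (hv : ((ℓ : ℕ) : 𝓞 K) ∈ v.asIdeal) (s : Bool) :
    ∃ e : galoisCohomology (((W.baseChange K).torsionGaloisModule ((p ^ 1 : ℕ) : ℤ)).toLocal (Sum.inr v)) 1,
      ∀ x : Vp W K p, conjAct W c ((p ^ 1 : ℕ) : ℤ) x = sgnP s • x →
        x ∈ selmerLocalKer (W.baseChange K) (v.adicCompletion K) ((p ^ 1 : ℕ) : ℤ) →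
        ∃ a : ℤ, galoisCohomology.localization ((W.baseChange K).torsionGaloisModule ((p ^ 1 : ℕ) : ℤ))
          (Sum.inr v) 1 x = a • e := by
  classical
  have hp : p.Prime := Fact.out
  have hp1 : Nat.Prime (p ^ 1) := by rw [pow_one]; exact hp
  have hp12 : p ^ 1 ≠ 2 := by rw [pow_one]; exact hp2
  have hpZ : ((p ^ 1 : ℕ) : ℤ) ≠ 0 := by exact_mod_cast hp1.ne_zero
  -- ### Gross's Kolyvagin prime; `v = λ`; good reduction and `p ∉ λ`
  have hℓG := isKolyvaginPrime_pow_one_of_zhang W K p hK hp2 hsurj hℓ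
  have hvw : v = hℓG.place := hℓG.mem_iff.mp hv
  subst hvw
  obtain ⟨hgood, hpv⟩ := GlobalDuality.hasGoodReductionAt_of_zhangKolyvaginPrime W K hℓ hℓG.place hv 1
  have hvbad : hℓG.place ∉ (W.baseChange K).badPlaces (𝓞 K) := fun h ↦ h hgood
  haveI : CharZero (hℓG.place.adicCompletion K) :=
    charZero_of_injective_algebraMap (algebraMap K (hℓG.place.adicCompletion K)).injective
  -- ### the prime `𝔓 ∣ λ` of `\bar ℤ_K` cut out by the chosen embedding `K̄ → \bar{K_λ}`
  obtain ⟨𝔐, h𝔐⟩ := hℓG.place.localPrimesAbove_nonempty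
  have h𝔓 : hℓG.place.primeBelow (closureEmb (K := K) (hℓG.place.adicCompletion K)) 𝔐 ∈ hℓG.place.primesAbove :=
    HeightOneSpectrum.primeBelow_mem_primesAbove h𝔐
  -- ### Gross's Frobenius lift at `𝔓`
  obtain ⟨h, c₀, F, ht, -, -, -, -, hF, -, hFT, hcF, -, ⟨Qp, hQp0, hQp⟩, ⟨Qm, hQm0, hQm⟩, -⟩ :=
    exists_frobeniusLift_of_isKolyvaginPrime W hK hp1 hp12 hc hℓG h𝔓
  have hFT' : F ∈ torsionFixing (W.baseChange K) ((p ^ 1 : ℕ) : ℤ) := hFT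
  have hI : (hℓG.place.primeBelow (closureEmb (K := K) (hℓG.place.adicCompletion K)) 𝔐).inertia
      (absoluteGaloisGroup K) ≤ torsionFixing (W.baseChange K) ((p ^ 1 : ℕ) : ℤ) :=
    inertia_le_torsionFixing (W.baseChange K) hvbad hpv _ h𝔐
  have hopen : IsOpen (torsionFixing (W.baseChange K) ((p ^ 1 : ℕ) : ℤ) : Set (absoluteGaloisGroup K)) :=
    isOpen_torsionFixing (W.baseChange K) hpZ
  have hbij := (torsionPointsMap_bijective (W.baseChange K) (hℓG.place.adicCompletion K) (n := p ^ 1)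
    hp1.ne_zero).2
  -- ### Prop. 9.6: for `x` Selmer at `λ`, `loc_λ x = 0 ⟺ [x, F] = 0`
  have hcrit : ∀ x : Vp W K p, x ∈ selmerLocalKer (W.baseChange K) (hℓG.place.adicCompletion K) ((p ^ 1 : ℕ) : ℤ) →
      (galoisCohomology.localization ((W.baseChange K).torsionGaloisModule ((p ^ 1 : ℕ) : ℤ)) (Sum.inr hℓG.place) 1
          x = 0 ↔ h1Eval (W.baseChange K) ((p ^ 1 : ℕ) : ℤ) x F = 0) := by
    intro x hx
    have hxunr : x ∈ unramifiedKer (geomTorsion (W.baseChange K) ((p ^ 1 : ℕ) : ℤ))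
        (hℓG.place.primeBelow (closureEmb (K := K) (hℓG.place.adicCompletion K)) 𝔐) := by
      rw [← (W.baseChange K).selmerLocalKer_eq_unramifiedKer hgood hpv h𝔓]; exact hx
    rw [← mem_torsionLocalKer_iff_localization_eq_zero_P W K p hℓG.place x]
    exact mem_torsionLocalKer_iff_h1Eval_eq_zero (W.baseChange K) ((p ^ 1 : ℕ) : ℤ) h𝔐 hF hFT' hI hopen hbij hxunr
  -- ### `[x, F]` is a `t`-eigenvector of sign `s` for `x ∈ H¹(K, E[p])^{s}`
  have hsign : ∀ x : Vp W K p, conjAct W c ((p ^ 1 : ℕ) : ℤ) x = sgnP s • x →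
      ht.torsionMap W ((p ^ 1 : ℕ) : ℤ) (h1Eval (W.baseChange K) ((p ^ 1 : ℕ) : ℤ) x F) =
        sgnP s • h1Eval (W.baseChange K) ((p ^ 1 : ℕ) : ℤ) x F :=
    fun x hx ↦ torsionMap_h1Eval_eq_of_conjAct_eq W ht ((p ^ 1 : ℕ) : ℤ) hFT' hcF hx
  -- ### `E[p] ≅ (ℤ/p)²`, killed by `p`; eigenvectors of signs `s` and `-s`
  have hν : sgnP s = 1 ∨ sgnP s = -1 := by cases s <;> simp [sgnP]
  have hTp : ∀ P : geomTorsion (W.baseChange K) ((p ^ 1 : ℕ) : ℤ), (p ^ 1) • P = 0 := fun P ↦ by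
    have := (mem_geomTorsion_iff (W.baseChange K) ((p ^ 1 : ℕ) : ℤ) _).mp P.2
    apply Subtype.ext
    rw [AddSubgroupClass.coe_nsmul, ← natCast_zsmul]
    exact this
  have hcard : Nat.card (geomTorsion (W.baseChange K) ((p ^ 1 : ℕ) : ℤ)) = (p ^ 1) ^ 2 :=
    card_torsionPoints_eq_sq_holds (W.baseChange K) (AlgebraicClosure K) (n := p ^ 1) (by exact_mod_cast hp1.ne_zero)
  obtain ⟨Q₁, Q₂, hQ₁0, hQ₁, hQ₂0, hQ₂⟩ : ∃ Q₁ Q₂ : geomTorsion (W.baseChange K) ((p ^ 1 : ℕ) : ℤ), Q₁ ≠ 0 ∧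
      ht.torsionMap W ((p ^ 1 : ℕ) : ℤ) Q₁ = sgnP s • Q₁ ∧ Q₂ ≠ 0 ∧
        ht.torsionMap W ((p ^ 1 : ℕ) : ℤ) Q₂ = -(sgnP s • Q₂) := by
    cases s
    · refine ⟨Qm, Qp, hQm0, ?_, hQp0, ?_⟩
      · rw [hQm, show sgnP false = -1 from rfl, neg_one_zsmul]
      · rw [hQp, show sgnP false = -1 from rfl, neg_one_zsmul, neg_neg]
    · refine ⟨Qp, Qm, hQp0, ?_, hQm0, ?_⟩
      · rw [hQp, show sgnP true = 1 from rfl, one_zsmul]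
      · rw [hQm, show sgnP true = 1 from rfl, one_zsmul]
  -- ### the line
  by_cases hex : ∃ x₀ : Vp W K p, conjAct W c ((p ^ 1 : ℕ) : ℤ) x₀ = sgnP s • x₀ ∧
      x₀ ∈ selmerLocalKer (W.baseChange K) (hℓG.place.adicCompletion K) ((p ^ 1 : ℕ) : ℤ) ∧
      h1Eval (W.baseChange K) ((p ^ 1 : ℕ) : ℤ) x₀ F ≠ 0
  · obtain ⟨x₀, hx₀s, hx₀K, hx₀0⟩ := hex
    refine ⟨galoisCohomology.localization ((W.baseChange K).torsionGaloisModule ((p ^ 1 : ℕ) : ℤ))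
      (Sum.inr hℓG.place) 1 x₀, fun x hxs hxK ↦ ?_⟩
    -- `[x, F] ∈ ℤ [x₀, F]` (the `s`-eigen-line is `ℤ [x₀, F]`)
    have hmem : h1Eval (W.baseChange K) ((p ^ 1 : ℕ) : ℤ) x F ∈
        AddSubgroup.zmultiples (h1Eval (W.baseChange K) ((p ^ 1 : ℕ) : ℤ) x₀ F) :=
      KolyLocal.mem_zmultiples_of_eigen_of_eigen hp1 hp12 hcard hTp (ht.torsionMap W ((p ^ 1 : ℕ) : ℤ))
        hν hx₀0 (hsign x₀ hx₀s) hQ₂0 hQ₂ (hsign x hxs)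
    obtain ⟨a, ha⟩ := AddSubgroup.mem_zmultiples_iff.mp hmem
    refine ⟨a, ?_⟩
    -- `x - a x₀` is Selmer at `λ` with `[x - a x₀, F] = 0`, so `loc_λ (x - a x₀) = 0`
    have hdiff : x - a • x₀ ∈ selmerLocalKer (W.baseChange K) (hℓG.place.adicCompletion K) ((p ^ 1 : ℕ) : ℤ) :=
      sub_mem hxK (AddSubgroup.zsmul_mem _ hx₀K a)
    have hval0 : h1Eval (W.baseChange K) ((p ^ 1 : ℕ) : ℤ) (x - a • x₀) F = 0 := by
      rw [sub_eq_add_neg, h1Eval_add (W.baseChange K) ((p ^ 1 : ℕ) : ℤ) _ _ hFT',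
        h1Eval_neg (W.baseChange K) ((p ^ 1 : ℕ) : ℤ) _ hFT', h1Eval_zsmul (W.baseChange K) ((p ^ 1 : ℕ) : ℤ) _ _
        hFT', ha, add_neg_cancel]
    have hloc0 := (hcrit (x - a • x₀) hdiff).mpr hval0
    have hsub := map_sub (galoisCohomology.localization ((W.baseChange K).torsionGaloisModule ((p ^ 1 : ℕ) : ℤ))
      (Sum.inr hℓG.place) 1) x (a • x₀)
    have hsm := map_zsmul (galoisCohomology.localization ((W.baseChange K).torsionGaloisModule ((p ^ 1 : ℕ) : ℤ))
      (Sum.inr hℓG.place) 1) a x₀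
    exact (sub_eq_zero.mp (hsub.symm.trans hloc0)).trans hsm
  · -- no eigen-Selmer class with `[x₀, F] ≠ 0`: all their localisations vanish
    push Not at hex
    refine ⟨0, fun x hxs hxK ↦ ⟨0, ?_⟩⟩
    rw [zero_smul]
    exact (hcrit x hxK).mpr (hex x hxs hxK)

end Line

end Summit.BirchSwinnertonDyer.BirchSwinnertonDyer.Theorems.AdditiveKoly

end
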